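import Literature.Algebra.Homology.TensorObjFinrank
import Mathlib.Algebra.Category.ModuleCat.Products
import Mathlib.LinearAlgebra.Trace
import HarnessLib

/-!
# The trace of an endomorphism of a direct sum ∕ categorical coproduct respecting the summands

Layer `Literature/Algebra/Homology` (pure linear algebra over Mathlib; proved theorems only, 0 definitions, 0 named facts, no instances,
no notation). For a family `M i` (`i : ι`, ANY index type) of finite-dimensional vector spaces over a field, trivial off a `Finset s`, and
an endomorphism `T` of the direct sum `⨁ i, M i` (resp. of Mathlib's categorical coproduct `∐ F` in `ModuleCat K`) which preserves every summand,
acting there as `g i` (`T ∘ lof i = lof i ∘ g i`, resp. `Sigma.ι F i ≫ T = g i ≫ Sigma.ι F i`):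

* `eq_sum_lof_comp_comp_component` — `T = Σ_{i ∈ s} lof i ∘ g i ∘ component i`;
* **`trace_directSum_eq_sum : tr(T) = Σ_{i ∈ s} tr(g i)`** (additivity of the trace + `tr(lof ∘ g ∘ component) = tr(g ∘ component ∘ lof) = tr(g)`,
  Mathlib `LinearMap.trace_comp_comm'`); Mathlib has the INTERNAL-direct-sum form `LinearMap.trace_eq_sum_trace_restrict'`
  (`Algebra/DirectSum/LinearMap`), not this external ∕ finitely-supported one;
* **`trace_sigmaObj_map_eq_sum : tr(T : ∐ F ⟶ ∐ F) = Σ_{i ∈ s} tr(g i)`** — transported along Mathlib's `ModuleCat.coprodIsoDirectSum`.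

Row `TensorObjFinrank`'s `moduleFinite_directSum_of_subsingleton` is used BY NAME. LEAF 1 of the trace companion of row
`EulerCharacteristicTotalComplex` (LEAF 2 = `LefschetzNumberTotalComplex`: the terms of a total complex are such coproducts). Library only (cell
`pub-hodge-ring2`, count-neutral); proves nothing about any crux, route or conjecture.

## References

* A. Hatcher, *Algebraic Topology* (2002), §2.C, proof of Thm. 2C.3 ("trace is additive for endomorphisms of short exact sequences",
  in particular of direct sums). [HatcherAT2002]
* C. A. Weibel, *An introduction to homological algebra* (1994), 1.2.6 (total complex as a coproduct). [Weibel1994]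
-/

open CategoryTheory CategoryTheory.Limits
open DirectSum

universe v u w

namespace Literature.Algebra.Homology.TraceCoproduct

variable {K : Type u} [Field K]

/-! ### Direct sums -/

section DirectSum

variable {ι : Type w} [DecidableEq ι] (M : ι → Type v) [∀ i, AddCommGroup (M i)] [∀ i, Module K (M i)] [∀ i, Module.Finite K (M i)]
  (s : Finset ι) (hs : ∀ i, i ∉ s → Subsingleton (M i)) (T : (⨁ i, M i) →ₗ[K] ⨁ i, M i) (g : ∀ i, M i →ₗ[K] M i)
  (hT : ∀ i, T ∘ₗ DirectSum.lof K ι M i = DirectSum.lof K ι M i ∘ₗ g i)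

include hs hT

omit [∀ i, Module.Finite K (M i)] in
/-- An endomorphism of `⨁ i, M i` preserving the summands, trivial off `s`, is `Σ_{i ∈ s} lof i ∘ g i ∘ component i`.
[cite: HatcherAT2002, §2.C (additivity of the trace)] -/
theorem eq_sum_lof_comp_comp_component :
    T = ∑ i ∈ s, DirectSum.lof K ι M i ∘ₗ (g i ∘ₗ DirectSum.component K ι M i) := by
  refine DirectSum.linearMap_ext K fun j => LinearMap.ext fun x => ?_
  rw [hT j, LinearMap.comp_apply, LinearMap.comp_apply, LinearMap.sum_apply]
  by_cases hj : j ∈ s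
  · rw [Finset.sum_eq_single j (fun i _ hij => ?_) (fun h => absurd hj h)]
    · rw [LinearMap.comp_apply, LinearMap.comp_apply, DirectSum.component.lof_self]
    · rw [LinearMap.comp_apply, LinearMap.comp_apply, DirectSum.component.of, dif_neg (fun h => hij h.symm), map_zero, map_zero]
  · haveI := hs j hj
    rw [Subsingleton.elim x 0, map_zero, map_zero]
    exact (Finset.sum_eq_zero fun i _ => by rw [map_zero]).symm

/-- **`tr(T) = Σ_{i ∈ s} tr(g i)`** for an endomorphism `T` of a finitely supported direct sum of finite-dimensional spaces preserving the summands.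
[cite: HatcherAT2002, §2.C (additivity of the trace)] -/
theorem trace_directSum_eq_sum : LinearMap.trace K (⨁ i, M i) T = ∑ i ∈ s, LinearMap.trace K (M i) (g i) := by
  haveI := TensorObjFinrank.moduleFinite_directSum_of_subsingleton (K := K) M s hs
  rw [eq_sum_lof_comp_comp_component M s hs T g hT, map_sum]
  refine Finset.sum_congr rfl fun i _ => ?_
  rw [LinearMap.trace_comp_comm', LinearMap.comp_assoc,
    show DirectSum.component K ι M i ∘ₗ DirectSum.lof K ι M i = LinearMap.id from
      LinearMap.ext fun x => DirectSum.component.lof_self (R := K) i x,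
    LinearMap.comp_id]

end DirectSum

/-! ### Categorical coproducts in `ModuleCat` -/

/-- **`tr(T : ∐ F ⟶ ∐ F) = Σ_{i ∈ s} tr(g i)`** for an endomorphism of a categorical coproduct of finite-dimensional spaces, trivial off the
`Finset s`, with `Sigma.ι F i ≫ T = g i ≫ Sigma.ι F i` (Mathlib `ModuleCat.coprodIsoDirectSum` + the direct-sum statement).
[cite: HatcherAT2002, §2.C (additivity of the trace)] [cite: Weibel1994, 1.2.6] -/
theorem trace_sigmaObj_map_eq_sum {α : Type} (F : α → ModuleCat.{v} K) [HasCoproduct F] [∀ a, Module.Finite K (F a)] (s : Finset α)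
    (hs : ∀ a, a ∉ s → Subsingleton (F a)) (T : ∐ F ⟶ ∐ F) (g : ∀ a, F a ⟶ F a) (hT : ∀ a, Sigma.ι F a ≫ T = g a ≫ Sigma.ι F a) :
    LinearMap.trace K (∐ F :) T.hom = ∑ a ∈ s, LinearMap.trace K (F a) (g a).hom := by
  classical
  let e := (ModuleCat.coprodIsoDirectSum F).toLinearEquiv
  rw [← LinearMap.trace_conj' T.hom e]
  refine trace_directSum_eq_sum (fun a => F a) s hs _ (fun a => (g a).hom) fun a => ?_
  have h1 : (e.symm : (⨁ a, F a) →ₗ[K] (∐ F :)) ∘ₗ DirectSum.lof K α (fun a => F a) a = (Sigma.ι F a).hom :=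
    congrArg ModuleCat.Hom.hom (ModuleCat.lof_coprodIsoDirectSum_inv F a)
  have h2 : (e : (∐ F :) →ₗ[K] ⨁ a, F a) ∘ₗ (Sigma.ι F a).hom = DirectSum.lof K α (fun a => F a) a :=
    congrArg ModuleCat.Hom.hom (ModuleCat.ι_coprodIsoDirectSum_hom F a)
  have h3 : T.hom ∘ₗ (Sigma.ι F a).hom = (Sigma.ι F a).hom ∘ₗ (g a).hom := by
    rw [← ModuleCat.hom_comp, hT a, ModuleCat.hom_comp]
  rw [LinearEquiv.conj_apply, LinearMap.comp_assoc, h1, LinearMap.comp_assoc, h3, ← LinearMap.comp_assoc, h2]
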